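import Summits.HubbardSuperconductivity.HubbardSuperconductivity.Theorems.AnisotropyChordSpinMonotoneTwoMagnonGramTP
import Summits.HubbardSuperconductivity.HubbardSuperconductivity.Theorems.AnisotropyChordConcavityOneMagnonCoordinates
import Literature.MathematicalPhysics.QuantumLattice.GroundStateEnclosure

/-!
# Route `AnisotropyChord`: the TOWER ORDER PARAMETER between the one- and two-magnon sectors is
# monotone on every connected vertex- and edge-transitive graph — the first slice of the theory
# seat's conjecture (TO) `VertexTransitiveTowerOverlapMonotone` (cycle 6, memo ROTOR-THEORY-6 §48/§52)

**Theorem** (`towerOverlap_oneTwo_monotone_of_edgeTransitive`).  `G` finite, connected, vertex- and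
edge-transitive; `ψ(Δ)` a normalised ground state of `H(Δ) = xxzHamiltonian 1 G (−1) Δ` in the
one-magnon sector `S^z_tot = |V|/2 − 1`, `φ(Δ)` one in the two-magnon sector `|V|/2 − 2`,
`S⁺_tot = Σ_x S⁺_x`.  Then for `Δ₁ ≤ Δ₂ ≤ 1`:
`|⟨ψ(Δ₁), S⁺_tot φ(Δ₁)⟩| ≤ |⟨ψ(Δ₂), S⁺_tot φ(Δ₂)⟩|` — the body of `VertexTransitiveTowerOverlapMonotone`
(`…SpinMonotoneDefs`) at `M = |V|/2 − 1`, with `IsEdgeTransitive` added and the lower bound on `Δ`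
dropped.

Proof (theory seat §52: "ψ₁ = flat for all Δ, so m₂ ∝ flat fidelity"):
* `xxz_mulVec_oneMagnonFlat` — on a `k`-regular graph the flat one-magnon vector `u = Σ_i |i⟩` is an
  eigenvector of `H(Δ)` for EVERY `Δ` (`H(Δ)|₁ = −½A + const`); `oneMagnon_sectorGS_eq_smul_flat` —
  by Perron–Frobenius it is THE sector ground state: every sector ground vector is `c·u`.
* `flatOne_star_dotProduct_raise_mulVec` — `⟨u, S⁺_tot φ⟩ = 2 ⟨flat₂, φ⟩` for `φ` in the two-magnon
  sector (each pair is raised from either of its two sites; double counting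
  `two_smul_sum_eq_sum_pairs`).
* hence `|⟨ψ(Δ), S⁺_tot φ(Δ)⟩| = (2/√|V|)·|⟨flat₂, φ(Δ)⟩|`, non-decreasing in `Δ ≤ 1` by ground-state
  OVERLAP MONOTONICITY with the flat state (`twoMagnon_overlapMonotone_of_edgeTransitive` at `Δ₂ = 1`,
  file `…SpinMonotoneTwoMagnonGramTP`, i.e. LEMMA TP₂).

H. Tasaki, *Physics and Mathematics of Quantum Many-Body Systems* (2020) §2.2, §2.4.  No definition
is introduced.
-/

set_option linter.dupNamespace false

noncomputable section

namespace Summit.HubbardSuperconductivity.HubbardSuperconductivity.Theorems.AnisotropyChord.TwoMagnon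

open Matrix Complex Finset
open scoped ComplexOrder
open Literature.MathematicalPhysics.QuantumLattice Literature.Probability.LatticeModels
open Literature.Combinatorics.SimpleGraph (IsVertexTransitive)
open Literature.Combinatorics.SimpleGraph.LovaszThetaEdgeTransitive (IsEdgeTransitive)
open Literature.Combinatorics.SimpleGraph.RankThreeStronglyRegular (isRegularOfDegree_of_isVertexTransitive)
open Summit.HubbardSuperconductivity.HubbardSuperconductivity.Theorems.AnisotropyChord.OneMagnon
open Summit.HubbardSuperconductivity.HubbardSuperconductivity.Theorems.PolyaSchurPairBoson

variable {V : Type*} [Fintype V] [DecidableEq V] (G : SimpleGraph V) [DecidableRel G.Adj]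

/-! ### The flat one-magnon vector -/

omit [DecidableEq V] in
/-- `Σ_j [i ∼ j] = d_i` in `ℂ`. [folklore] -/
theorem sum_ite_adj_one_complex (i : V) : (∑ j, (if G.Adj i j then (1 : ℂ) else 0)) = (G.degree i : ℂ) := by
  rw [Finset.sum_boole, ← SimpleGraph.card_neighborFinset_eq_degree, SimpleGraph.neighborFinset_eq_filter]

/-- **The flat one-magnon vector is an eigenvector of `H(Δ)` for every `Δ`** on a `k`-regular graph:
`H(Δ) u = (−Δ(|E|/4 − k/2) − k/2) u`, `u(σ) = [weight σ = 1]`. Tasaki (2020) §2.4 (one-magnon states,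
`H(Δ)|₁ = −½(A − ΔD) − Δ|E|/4`). [folklore] -/
theorem xxz_mulVec_oneMagnonFlat {k : ℕ} (hreg : G.IsRegularOfDegree k) (Δ : ℝ)
    {u : (V → Fin 2) → ℂ} (hu : ∀ σ, u σ = if (∑ z, (σ z : ℕ)) = 1 then 1 else 0) :
    (xxzHamiltonian 1 G (-1) Δ : Op V 2) *ᵥ u =
      ((-(Δ * ((G.edgeFinset.card : ℝ) / 4 - (k : ℝ) / 2)) - (k : ℝ) / 2 : ℝ) : ℂ) • u := by
  have hsupp : ∀ σ : V → Fin 2, (∑ z, (σ z : ℕ)) ≠ 1 → u σ = 0 := fun σ h => by rw [hu σ, if_neg h]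
  funext σ
  rw [Pi.smul_apply, smul_eq_mul]
  by_cases hσ : (∑ z, (σ z : ℕ)) = 1
  · obtain ⟨i, rfl⟩ := eq_single_of_weight_eq_one hσ
    rw [xxz_mulVec_single G Δ hsupp i, hu, if_pos (weight_single i)]
    have hs : ∑ j, (if G.Adj i j then u (Pi.single j 1) else 0) = (k : ℂ) := by
      rw [Finset.sum_congr rfl (fun j _ => show (if G.Adj i j then u (Pi.single j 1) else 0) =
          (if G.Adj i j then (1 : ℂ) else 0) by rw [hu, if_pos (weight_single j)]),
        sum_ite_adj_one_complex, hreg.degree_eq i]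
    rw [hs, hreg.degree_eq i]
    push_cast
    ring
  · rw [xxz_mulVec_apply_of_weight_ne G Δ hsupp σ hσ, hu σ, if_neg hσ, mul_zero]

/-- **Every one-magnon sector ground vector of a connected regular graph is a multiple of the flat
vector** (Perron–Frobenius: the positive eigenvector `u` pairs non-trivially with the non-negative
Perron ground vector, so its eigenvalue is the sector energy; then uniqueness). Tasaki (2020) §2.4.
[folklore] -/
theorem oneMagnon_sectorGS_eq_smul_flat (hG : G.Connected) {k : ℕ} (hreg : G.IsRegularOfDegree k)
    (Δ : ℝ) {u : (V → Fin 2) → ℂ} (hu : ∀ σ, u σ = if (∑ z, (σ z : ℕ)) = 1 then 1 else 0)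
    {ψ : (V → Fin 2) → ℂ} (hψ : ψ ∈ spinZSector (Λ := V) 1 ((Fintype.card V : ℝ) / 2 - 1))
    (hHψ : xxzHamiltonian 1 G (-1) Δ *ᵥ ψ =
      ((lowestEnergyInSector 1 (xxzHamiltonian 1 G (-1) Δ) ((Fintype.card V : ℝ) / 2 - 1) : ℝ) : ℂ) • ψ) :
    ∃ c : ℂ, ψ = c • u := by
  haveI : Nonempty V := hG.nonempty
  obtain ⟨i₀⟩ := ‹Nonempty V›
  have hsupp : ∀ σ : V → Fin 2, (∑ z, (σ z : ℕ)) ≠ 1 → u σ = 0 := fun σ h => by rw [hu σ, if_neg h]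
  have huK : u ∈ spinZSector (Λ := V) 1 ((Fintype.card V : ℝ) / 2 - 1) :=
    mem_oneMagnonSector_of_support hsupp
  have hu0 : u ≠ 0 := by
    intro h
    have h1 : u (Pi.single i₀ 1) = 0 := by rw [h]; rfl
    rw [hu, if_pos (weight_single i₀)] at h1
    exact one_ne_zero h1
  set H := (xxzHamiltonian 1 G (-1) Δ : Op V 2) with hHdef
  have hH : H.IsHermitian := xxzHamiltonian_isHermitian 1 G (-1) Δ
  set E₁ : ℝ := lowestEnergyInSector 1 H ((Fintype.card V : ℝ) / 2 - 1) with hE₁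
  set c : ℝ := (-(Δ * ((G.edgeFinset.card : ℝ) / 4 - (k : ℝ) / 2)) - (k : ℝ) / 2) with hcdef
  have hHu : H *ᵥ u = (c : ℂ) • u := xxz_mulVec_oneMagnonFlat G hreg Δ hu
  -- the Perron ground vector of the sector
  have hW : ∃ σ : TensorIndex V 2, (∑ z, (σ z : ℕ)) = 1 := ⟨Pi.single i₀ 1, weight_single i₀⟩
  obtain ⟨⟨ψ₀, hψ₀K, hψ₀0, hψ₀pos, hψ₀H⟩, -⟩ := xxz_sector_perronFrobenius G hG Δ 1 hW
  have esec : (((Fintype.card V * 1 : ℕ) : ℝ) / 2 - ((1 : ℕ) : ℝ)) = (Fintype.card V : ℝ) / 2 - 1 := by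
    push_cast; ring
  rw [esec] at hψ₀K hψ₀H
  -- `⟨u, ψ₀⟩ ≠ 0`
  have hsupp₀ := apply_eq_zero_of_mem_oneMagnonSector hψ₀K
  have huψ₀ : star u ⬝ᵥ ψ₀ = ∑ σ, ψ₀ σ := by
    rw [dotProduct]
    refine Finset.sum_congr rfl fun σ _ => ?_
    rw [Pi.star_apply, hu σ]
    split_ifs with h
    · simp
    · rw [hsupp₀ σ h]; simp
  have hS0 : (∑ σ, ψ₀ σ) ≠ 0 := by
    obtain ⟨σ₁, hσ₁⟩ : ∃ σ₁, ψ₀ σ₁ ≠ 0 := Function.ne_iff.mp hψ₀0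
    intro hS
    have hre : (∑ σ, ψ₀ σ).re = 0 := by rw [hS, Complex.zero_re]
    rw [Complex.re_sum] at hre
    have hle : (ψ₀ σ₁).re ≤ ∑ σ, (ψ₀ σ).re :=
      Finset.single_le_sum (fun σ _ => (hψ₀pos σ).1) (Finset.mem_univ σ₁)
    have hpos : 0 < (ψ₀ σ₁).re := by
      rcases (hψ₀pos σ₁).1.lt_or_eq with h | h
      · exact h
      · exact absurd (Complex.ext (by rw [Complex.zero_re]; exact h.symm)
          (by rw [Complex.zero_im]; exact (hψ₀pos σ₁).2)) hσ₁
    linarith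
  -- the eigenvalue of `u` is the sector energy
  have h1 : star u ⬝ᵥ (H *ᵥ ψ₀) = (c : ℂ) * (star u ⬝ᵥ ψ₀) := star_dotProduct_mulVec_of_eigenvector hH hHu ψ₀
  have h2 : star u ⬝ᵥ (H *ᵥ ψ₀) = (E₁ : ℂ) * (star u ⬝ᵥ ψ₀) := by
    rw [hψ₀H, dotProduct_smul, smul_eq_mul]
  have hcE : (c : ℂ) = (E₁ : ℂ) := by
    have := h1.symm.trans h2
    rw [huψ₀] at this
    exact mul_right_cancel₀ hS0 this
  rw [hcE] at hHu
  exact sectorGS_smul_of_sectorGS G hG Δ _ huK hu0 hHu hψ hHψ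

/-! ### `⟨u, S⁺_tot φ⟩ = 2 ⟨flat₂, φ⟩` -/

omit [Fintype V] in
/-- Raising site `x ≠ i` of the one-magnon configuration `e_i` to `1` gives the pair `e_i + e_x`.
[folklore] -/
theorem update_single_eq_pair {i x : V} (hxi : x ≠ i) :
    Function.update (Pi.single i (1 : Fin 2) : V → Fin 2) x 1 = Pi.single i 1 + Pi.single x 1 := by
  funext z
  by_cases hz : z = x
  · subst hz
    rw [Function.update_self, Pi.add_apply, Pi.single_eq_same, Pi.single_eq_of_ne hxi, zero_add]
  · rw [Function.update_of_ne hz, Pi.add_apply, Pi.single_eq_of_ne (Ne.symm (Ne.symm hz) : z ≠ x),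
      add_zero]

/-- **`⟨u, S⁺_tot φ⟩ = 2 ⟨flat₂, φ⟩`**: the flat one-magnon vector pairs with `S⁺_tot φ` to twice the
flat two-magnon overlap of `φ` (each weight-2 configuration is reached from either of its two
sites; spin-½ raising amplitudes are `1`). Tasaki (2020) §2.2 eq. (2.2.5), §2.4. [folklore] -/
theorem flatOne_star_dotProduct_raise_mulVec {u f φ : (V → Fin 2) → ℂ}
    (hu : ∀ σ, u σ = if (∑ z, (σ z : ℕ)) = 1 then 1 else 0)
    (hf : ∀ σ, f σ = if (∑ z, (σ z : ℕ)) = 2 then 1 else 0)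
    (hφ : ∀ σ : V → Fin 2, (∑ z, (σ z : ℕ)) ≠ 2 → φ σ = 0) :
    star u ⬝ᵥ ((∑ x, onSite x (spinRaise 1) : Op V 2) *ᵥ φ) = 2 * (star f ⬝ᵥ φ) := by
  -- the raising operator on a one-magnon configuration
  have hraise : ∀ i : V, ((∑ x, onSite x (spinRaise 1) : Op V 2) *ᵥ φ) (Pi.single i 1) =
      ∑ x, (if i = x then 0 else φ (Pi.single i 1 + Pi.single x 1)) := by
    intro i
    rw [← LiebMattis.totalSpin_raise_eq_sum_onSite 1, LiebMattis.raise_mulVec_apply 1 φ]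
    refine Finset.sum_congr rfl fun x _ => ?_
    rw [LiebMattis.sum_spinRaise_apply_mul 1 φ]
    by_cases hxi : x = i
    · subst hxi
      have hx : ¬ (((Pi.single x (1 : Fin 2) : V → Fin 2) x).val + 1 < 1 + 1) := by simp
      rw [dif_neg hx, if_pos rfl]
    · have hval : ((Pi.single i (1 : Fin 2) : V → Fin 2) x).val = 0 := by
        rw [Pi.single_eq_of_ne hxi]; rfl
      have hx : ((Pi.single i (1 : Fin 2) : V → Fin 2) x).val + 1 < 1 + 1 := by rw [hval]; norm_num
      rw [dif_pos hx, if_neg (Ne.symm hxi)]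
      have h1 : (⟨((Pi.single i (1 : Fin 2) : V → Fin 2) x).val + 1, hx⟩ : Fin 2) = 1 :=
        Fin.ext (by simp [hval])
      rw [h1, update_single_eq_pair hxi]
      simp [hval]
  -- pair with the flat one-magnon vector
  have hsuppU : ∀ σ : V → Fin 2, (∑ z, (σ z : ℕ)) ≠ 1 →
      star (u σ) * ((∑ x, onSite x (spinRaise 1) : Op V 2) *ᵥ φ) σ = 0 := by
    intro σ h; rw [hu σ, if_neg h, star_zero, zero_mul]
  rw [dotProduct, show (∑ σ, star u σ * ((∑ x, onSite x (spinRaise 1) : Op V 2) *ᵥ φ) σ) =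
      ∑ σ, star (u σ) * ((∑ x, onSite x (spinRaise 1) : Op V 2) *ᵥ φ) σ from rfl,
    sum_eq_sum_single _ hsuppU]
  rw [Finset.sum_congr rfl (fun i _ => by rw [hu, if_pos (weight_single i), star_one, one_mul, hraise i]),
    star_flat_dotProduct hf hφ]
  have h2 := two_smul_sum_eq_sum_pairs φ hφ
  rw [two_smul] at h2
  rw [← h2]
  ring

/-! ### The tower order parameter between the one- and two-magnon sectors -/

/-- **(TO) between the one- and two-magnon sectors on connected vertex- and edge-transitive graphs**
(see the module docstring): for `Δ₁ ≤ Δ₂ ≤ 1`, normalised one-magnon sector ground states `ψᵢ` and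
two-magnon sector ground states `φᵢ` of `H(Δᵢ)`,
`|⟨ψ₁, S⁺_tot φ₁⟩| ≤ |⟨ψ₂, S⁺_tot φ₂⟩|`.  Theory seat memo ROTOR-THEORY-6 §48, §52 ((TO) for W = 2,
one contact orbit); Tasaki (2020) §2.4. [folklore] -/
theorem towerOverlap_oneTwo_monotone_of_edgeTransitive (hG : G.Connected) (hVT : IsVertexTransitive G)
    (hET : IsEdgeTransitive G) {Δ₁ Δ₂ : ℝ} (h12 : Δ₁ ≤ Δ₂) (h2 : Δ₂ ≤ 1)
    {ψ₁ φ₁ ψ₂ φ₂ : (V → Fin 2) → ℂ}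
    (g₁m : ψ₁ ∈ spinZSector (Λ := V) 1 ((Fintype.card V : ℝ) / 2 - 1)) (g₁n : star ψ₁ ⬝ᵥ ψ₁ = 1)
    (g₁e : xxzHamiltonian 1 G (-1) Δ₁ *ᵥ ψ₁ =
      ((lowestEnergyInSector 1 (xxzHamiltonian 1 G (-1) Δ₁) ((Fintype.card V : ℝ) / 2 - 1) : ℝ) : ℂ) • ψ₁)
    (f₁m : φ₁ ∈ spinZSector (Λ := V) 1 ((Fintype.card V : ℝ) / 2 - 1 - 1)) (f₁n : star φ₁ ⬝ᵥ φ₁ = 1)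
    (f₁e : xxzHamiltonian 1 G (-1) Δ₁ *ᵥ φ₁ =
      ((lowestEnergyInSector 1 (xxzHamiltonian 1 G (-1) Δ₁) ((Fintype.card V : ℝ) / 2 - 1 - 1) : ℝ) : ℂ) • φ₁)
    (g₂m : ψ₂ ∈ spinZSector (Λ := V) 1 ((Fintype.card V : ℝ) / 2 - 1)) (g₂n : star ψ₂ ⬝ᵥ ψ₂ = 1)
    (g₂e : xxzHamiltonian 1 G (-1) Δ₂ *ᵥ ψ₂ =
      ((lowestEnergyInSector 1 (xxzHamiltonian 1 G (-1) Δ₂) ((Fintype.card V : ℝ) / 2 - 1) : ℝ) : ℂ) • ψ₂)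
    (f₂m : φ₂ ∈ spinZSector (Λ := V) 1 ((Fintype.card V : ℝ) / 2 - 1 - 1)) (f₂n : star φ₂ ⬝ᵥ φ₂ = 1)
    (f₂e : xxzHamiltonian 1 G (-1) Δ₂ *ᵥ φ₂ =
      ((lowestEnergyInSector 1 (xxzHamiltonian 1 G (-1) Δ₂) ((Fintype.card V : ℝ) / 2 - 1 - 1) : ℝ) : ℂ) • φ₂) :
    ‖star ψ₁ ⬝ᵥ ((∑ x, onSite x (spinRaise 1) : Op V 2) *ᵥ φ₁)‖ ≤
      ‖star ψ₂ ⬝ᵥ ((∑ x, onSite x (spinRaise 1) : Op V 2) *ᵥ φ₂)‖ := by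
  have e2 : (Fintype.card V : ℝ) / 2 - 1 - 1 = (Fintype.card V : ℝ) / 2 - 2 := by ring
  rw [e2] at f₁m f₁e f₂m f₂e
  haveI : Nonempty V := hG.nonempty
  obtain ⟨i₀⟩ := ‹Nonempty V›
  have hreg : G.IsRegularOfDegree (G.degree i₀) := isRegularOfDegree_of_isVertexTransitive hVT i₀
  -- flat vectors
  set u : (V → Fin 2) → ℂ := fun σ => if (∑ z, (σ z : ℕ)) = 1 then 1 else 0 with hudef
  have hu : ∀ σ, u σ = if (∑ z, (σ z : ℕ)) = 1 then 1 else 0 := fun σ => rfl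
  set f : (V → Fin 2) → ℂ := fun σ => if (∑ z, (σ z : ℕ)) = 2 then 1 else 0 with hfdef
  have hf : ∀ σ, f σ = if (∑ z, (σ z : ℕ)) = 2 then 1 else 0 := fun σ => rfl
  -- the one-magnon ground states are unimodular multiples of `u` with equal moduli
  obtain ⟨c₁, hc₁⟩ := oneMagnon_sectorGS_eq_smul_flat G hG hreg Δ₁ hu g₁m g₁e
  obtain ⟨c₂, hc₂⟩ := oneMagnon_sectorGS_eq_smul_flat G hG hreg Δ₂ hu g₂m g₂e
  have huu : (star u ⬝ᵥ u).re = Fintype.card V := by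
    have hsupp : ∀ σ : V → Fin 2, (∑ z, (σ z : ℕ)) ≠ 1 → star (u σ) * u σ = 0 := by
      intro σ h; rw [hu σ, if_neg h, mul_zero]
    rw [dotProduct, show (∑ σ, star u σ * u σ) = ∑ σ, star (u σ) * u σ from rfl,
      sum_eq_sum_single _ hsupp]
    rw [Finset.sum_congr rfl (fun i _ => by rw [hu, if_pos (weight_single i), star_one, one_mul]),
      Finset.sum_const, Finset.card_univ, nsmul_eq_mul, mul_one, Complex.natCast_re]
  have hmod : ∀ {ψ : (V → Fin 2) → ℂ} {c : ℂ}, star ψ ⬝ᵥ ψ = 1 → ψ = c • u →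
      ‖c‖ ^ 2 * (Fintype.card V : ℝ) = 1 := by
    intro ψ c hn hc
    have h := congrArg Complex.re hn
    rw [hc, star_smul, smul_dotProduct, dotProduct_smul, smul_eq_mul, smul_eq_mul, ← mul_assoc,
      Complex.star_def, Complex.conj_mul', ← Complex.ofReal_pow, Complex.re_ofReal_mul, huu,
      Complex.one_re] at h
    exact h
  have hm₁ := hmod g₁n hc₁
  have hm₂ := hmod g₂n hc₂
  have hcc : ‖c₁‖ = ‖c₂‖ := by
    have hV : (0 : ℝ) < Fintype.card V := by exact_mod_cast Fintype.card_pos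
    have hsq : ‖c₁‖ ^ 2 = ‖c₂‖ ^ 2 := by nlinarith
    have h3 : (‖c₁‖ - ‖c₂‖) * (‖c₁‖ + ‖c₂‖) = 0 := by
      have : (‖c₁‖ - ‖c₂‖) * (‖c₁‖ + ‖c₂‖) = ‖c₁‖ ^ 2 - ‖c₂‖ ^ 2 := by ring
      rw [this, hsq, sub_self]
    rcases mul_eq_zero.1 h3 with h | h
    · linarith
    · have hc₁0 : ‖c₁‖ ≠ 0 := by
        intro h0; rw [h0] at hm₁; simp at hm₁
      have : 0 < ‖c₁‖ := lt_of_le_of_ne (norm_nonneg _) (Ne.symm hc₁0)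
      linarith [norm_nonneg c₂]
  -- reduce to the flat two-magnon overlaps
  have hsupp₁ := apply_eq_zero_of_mem_twoMagnonSector f₁m
  have hsupp₂ := apply_eq_zero_of_mem_twoMagnonSector f₂m
  rw [hc₁, hc₂, norm_star_smul_dotProduct, norm_star_smul_dotProduct, hcc,
    flatOne_star_dotProduct_raise_mulVec hu hf hsupp₁, flatOne_star_dotProduct_raise_mulVec hu hf hsupp₂,
    norm_mul, norm_mul]
  refine mul_le_mul_of_nonneg_left (mul_le_mul_of_nonneg_left ?_ (norm_nonneg _)) (norm_nonneg _)
  -- the flat two-magnon vector is the normalised ground state at `Δ = 1` (up to a positive scalar)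
  have hsupp_u₁ := apply_eq_zero_of_mem_twoMagnonSector f₁m
  obtain ⟨σ₀, hσ₀⟩ := Function.ne_iff.mp
    (show φ₁ ≠ 0 from fun h => by rw [h, dotProduct_zero] at f₁n; exact zero_ne_one f₁n)
  have hw : (∑ z, (σ₀ z : ℕ)) = 2 := by
    by_contra h
    exact hσ₀ (hsupp_u₁ σ₀ h)
  obtain ⟨N, hNdef⟩ : ∃ N : ℕ, N = (Finset.univ.filter fun σ : V → Fin 2 => (∑ z, (σ z : ℕ)) = 2).card :=
    ⟨_, rfl⟩
  have hff : star f ⬝ᵥ f = (N : ℂ) := by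
    rw [star_flat_dotProduct hf (fun σ h => by rw [hf σ, if_neg h]), hNdef, Finset.card_filter]
    push_cast
    exact Finset.sum_congr rfl fun σ _ => by rw [hf σ]
  have hNpos : 0 < N := by
    rw [hNdef, Finset.card_pos]
    exact ⟨σ₀, Finset.mem_filter.2 ⟨Finset.mem_univ _, hw⟩⟩
  have hf0 : f ≠ 0 := by
    intro h
    have : (N : ℂ) = 0 := by rw [← hff, h, dotProduct_zero]
    exact hNpos.ne' (by exact_mod_cast this)
  obtain ⟨r, hrdef⟩ : ∃ r : ℝ, r = 1 / Real.sqrt (N : ℝ) := ⟨_, rfl⟩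
  have hNr0 : (0 : ℝ) < N := by exact_mod_cast hNpos
  have hrpos : 0 < r := by rw [hrdef]; exact div_pos one_pos (Real.sqrt_pos.2 hNr0)
  have hr2 : r ^ 2 * N = 1 := by
    rw [hrdef, div_pow, one_pow, Real.sq_sqrt hNr0.le]
    field_simp
  set e : (V → Fin 2) → ℂ := ((r : ℝ) : ℂ) • f with hedef
  have heK : e ∈ spinZSector (Λ := V) 1 ((Fintype.card V : ℝ) / 2 - 2) :=
    Submodule.smul_mem _ _ (flat_mem_twoMagnonSector hf)
  have he1 : star e ⬝ᵥ e = 1 := by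
    rw [hedef, star_smul, smul_dotProduct, dotProduct_smul, hff, smul_eq_mul, smul_eq_mul,
      Complex.star_def, Complex.conj_ofReal, ← mul_assoc, ← Complex.ofReal_mul, ← pow_two,
      ← Complex.ofReal_natCast, ← Complex.ofReal_mul, hr2, Complex.ofReal_one]
  have hHe : xxzHamiltonian 1 G (-1) 1 *ᵥ e =
      ((lowestEnergyInSector 1 (xxzHamiltonian 1 G (-1) 1) ((Fintype.card V : ℝ) / 2 - 2) : ℝ) : ℂ) • e := by
    rw [hedef, mulVec_smul, lowestEnergy_at_one G hf hf0, xxzOne_mulVec_flat G hf, smul_comm]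
    push_cast
    rfl
  have key := twoMagnon_overlapMonotone_of_edgeTransitive G hG hVT hET h12 h2 le_rfl
    f₁m f₁n f₁e f₂m f₂n f₂e heK he1 hHe
  -- key : ‖⟨φ₁, e⟩‖ ≤ ‖⟨φ₂, e⟩‖
  rw [hedef, norm_star_dotProduct_smul, norm_star_dotProduct_smul, norm_star_dotProduct_comm φ₁ f,
    norm_star_dotProduct_comm φ₂ f] at key
  have hrn : 0 < ‖((r : ℝ) : ℂ)‖ := by rw [Complex.norm_real, Real.norm_of_nonneg hrpos.le]; exact hrpos
  exact le_of_mul_le_mul_left key hrn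

end Summit.HubbardSuperconductivity.HubbardSuperconductivity.Theorems.AnisotropyChord.TwoMagnon
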